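import Summits.AtomisticToContinuum.HydrodynamicLimit.Theorems.JParityClosureRateFloorWindowFloorRung0
import Summits.AtomisticToContinuum.HydrodynamicLimit.Theorems.JParityClosureRateFloorTubeChebyshevSharp
import Summits.AtomisticToContinuum.HydrodynamicLimit.Theorems.JParityClosureRateFloorMarkovWindows
import Summits.AtomisticToContinuum.HydrodynamicLimit.Theorems.JParityClosureRateFloorStaticFloorDeterministic
import Summits.AtomisticToContinuum.HydrodynamicLimit.Theorems.JParityClosureRateFloorCutoffLoss
import Literature.MathematicalPhysics.KineticTheory.EvenCollisionTubeFunctional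
import Literature.MathematicalPhysics.KineticTheory.HardSphereCanonicalTorus
import HarnessLib

/-!
# Line `Sketch` of crux `RateFloor`, rung 0: the core estimate of the static floor at a fixed particle number
# (helper file, `--supports stmt-AtomisticToContinuum-13080`)

The fixed-`N` heart of `stub_staticOpacityFloorRung0 ⇐ Plateau′` (c2 lane): given ALL parameters and ALL smallness
conditions as hypotheses (the assembly `JParityClosureRateFloorStaticFloorRung0` chooses them), the rung-0 law of the event
`{S_W < σ³ I_B / 8 − η}` has probability `≤ δ`:

`{S_W < σ³I_B/8 − η} ⊆ {I_B > Θ̄I_χ + η/σ³} ∪ {#bad windows ≥ fK}`: B-side hypothesis (`stub_pairFunctionalUpperInProbRung0`) + Markov over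
windows (`measure_le_card_windows_mem_le'`) with the one-window Chebyshev bound taken as the hypothesis `hcheb` (so that ANY form of the
decorrelation plateau can feed it: `measure_tubeSum_le_mean_sub_le_sharp` in the assembly); on the complement
`tubeSum_trunc_le_wouldBeSum`, `sum_ge_of_few_bad`, `integral_le_riemann_add` and the `η`-budget `floor_arith`.
-/

noncomputable section

open scoped BigOperators Topology ENNReal Classical
open MeasureTheory Set Filter Function
open Literature.Analysis.FluidPDE Literature.MathematicalPhysics.KineticTheory

namespace Summit.AtomisticToContinuum.HydrodynamicLimit.Theorems

namespace RateFloorStaticFloor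

open RateFloorLine RateFloorWindowFloor RateFloorTubeChebyshevSharp RateFloorMarkovWindows


/-- **The floor arithmetic** (pure real inequalities): the `η`-budget of the assembly. [folklore] -/
theorem floor_arith {σ3 P lam ΘL Θ ℓ X Iχ τ ω Δ Cχ ρ f KΔ SW η : ℝ}
    (hσ3 : 0 < σ3) (hP1 : σ3 / 2 ≤ P) (hP2 : P ≤ σ3) (hlam1 : 1 / 2 ≤ lam) (hlam2 : lam ≤ 1)
    (hΘL0 : 0 ≤ ΘL) (hΘLle : ΘL ≤ Θ) (hloss : Θ ≤ ΘL + ℓ)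
    (hX0 : 0 ≤ X) (hX : Iχ - 2 * τ * ω - Δ * Cχ ≤ X) (hIχ0 : 0 ≤ Iχ) (hIχle : Iχ ≤ τ * Cχ)
    (hτ : 0 < τ) (hω : 0 ≤ ω) (hΔ : 0 ≤ Δ) (hCχ : 0 ≤ Cχ) (hρ : 0 ≤ ρ) (hf : 0 ≤ f) (hKΔ0 : 0 ≤ KΔ) (hKΔ : KΔ ≤ τ)
    (hℓ : σ3 * ℓ * (τ * Cχ) / 4 ≤ η / 8) (hωη : σ3 * Θ * τ * ω / 2 ≤ η / 16) (hΔη : σ3 * (Θ + 1) * Δ * Cχ / 4 ≤ η / 16)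
    (hρη : ρ * σ3 * τ ≤ η / 8) (hfη : f * τ * σ3 * Cχ * (Θ + 1) ≤ η / 8)
    (hSW : P * lam * ΘL * X - ρ * P * KΔ - f * KΔ * P * Cχ * lam * ΘL ≤ SW) :
    σ3 * Θ / 4 * Iχ - η / 2 ≤ SW := by
  have hΘ0 : 0 ≤ Θ := hΘL0.trans hΘLle
  have hP0 : 0 ≤ P := by linarith
  -- the two subtracted terms
  have hB : ρ * P * KΔ ≤ η / 8 := by
    calc ρ * P * KΔ ≤ ρ * σ3 * τ := by
          have := mul_le_mul hP2 hKΔ hKΔ0 hσ3.le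
          calc ρ * P * KΔ = ρ * (P * KΔ) := by ring
            _ ≤ ρ * (σ3 * τ) := mul_le_mul_of_nonneg_left this hρ
            _ = ρ * σ3 * τ := by ring
      _ ≤ η / 8 := hρη
  have hC : f * KΔ * P * Cχ * lam * ΘL ≤ η / 8 := by
    have h1 : lam * ΘL ≤ Θ + 1 := by
      calc lam * ΘL ≤ 1 * ΘL := mul_le_mul_of_nonneg_right hlam2 hΘL0
        _ ≤ Θ + 1 := by linarith
    have h2 : KΔ * P ≤ τ * σ3 := mul_le_mul hKΔ hP2 hP0 hτ.le
    calc f * KΔ * P * Cχ * lam * ΘL = (f * Cχ) * (KΔ * P) * (lam * ΘL) := by ring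
      _ ≤ (f * Cχ) * (τ * σ3) * (Θ + 1) := by
          have hlΘ : 0 ≤ lam * ΘL := mul_nonneg (by linarith) hΘL0
          exact mul_le_mul (mul_le_mul_of_nonneg_left h2 (mul_nonneg hf hCχ)) h1 hlΘ (by positivity)
      _ = f * τ * σ3 * Cχ * (Θ + 1) := by ring
      _ ≤ η / 8 := hfη
  -- the main term
  have hcoef : σ3 * ΘL / 4 ≤ P * lam * ΘL := by
    have : σ3 / 4 ≤ P * lam := by
      calc σ3 / 4 ≤ P * (1 / 2) := by linarith
        _ ≤ P * lam := mul_le_mul_of_nonneg_left hlam1 hP0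
    calc σ3 * ΘL / 4 = (σ3 / 4) * ΘL := by ring
      _ ≤ (P * lam) * ΘL := mul_le_mul_of_nonneg_right this hΘL0
      _ = P * lam * ΘL := by ring
  have hA : σ3 * ΘL / 4 * (Iχ - 2 * τ * ω - Δ * Cχ) ≤ P * lam * ΘL * X :=
    (mul_le_mul_of_nonneg_left hX (by positivity)).trans (mul_le_mul_of_nonneg_right hcoef hX0)
  -- the loss terms
  have hℓ' : σ3 * Θ / 4 * Iχ ≤ σ3 * ΘL / 4 * Iχ + η / 8 := by
    have h1 : σ3 * Θ / 4 * Iχ ≤ σ3 * (ΘL + ℓ) / 4 * Iχ := by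
      refine mul_le_mul_of_nonneg_right ?_ hIχ0
      have := mul_le_mul_of_nonneg_left hloss hσ3.le
      linarith
    have h2 : σ3 * ℓ / 4 * Iχ ≤ η / 8 := by
      rcases le_or_gt 0 ℓ with hl | hl
      · calc σ3 * ℓ / 4 * Iχ ≤ σ3 * ℓ / 4 * (τ * Cχ) := mul_le_mul_of_nonneg_left hIχle (by positivity)
          _ = σ3 * ℓ * (τ * Cχ) / 4 := by ring
          _ ≤ η / 8 := hℓ
      · have hσl : σ3 * ℓ ≤ 0 := mul_nonpos_of_nonneg_of_nonpos hσ3.le hl.le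
        have : σ3 * ℓ / 4 * Iχ ≤ 0 := mul_nonpos_of_nonpos_of_nonneg (by linarith) hIχ0
        have hρσ := mul_nonneg (mul_nonneg hρ hσ3.le) hτ.le
        linarith
    have e : σ3 * (ΘL + ℓ) / 4 * Iχ = σ3 * ΘL / 4 * Iχ + σ3 * ℓ / 4 * Iχ := by ring
    linarith
  have hωterm : σ3 * ΘL / 4 * (2 * τ * ω) ≤ η / 16 := by
    calc σ3 * ΘL / 4 * (2 * τ * ω) ≤ σ3 * Θ / 4 * (2 * τ * ω) := by
          refine mul_le_mul_of_nonneg_right ?_ (by positivity)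
          have := mul_le_mul_of_nonneg_left hΘLle hσ3.le
          linarith
      _ = σ3 * Θ * τ * ω / 2 := by ring
      _ ≤ η / 16 := hωη
  have hΔterm : σ3 * ΘL / 4 * (Δ * Cχ) ≤ η / 16 := by
    calc σ3 * ΘL / 4 * (Δ * Cχ) ≤ σ3 * (Θ + 1) / 4 * (Δ * Cχ) := by
          refine mul_le_mul_of_nonneg_right ?_ (by positivity)
          have := mul_le_mul_of_nonneg_left (hΘLle.trans (le_add_of_nonneg_right zero_le_one)) hσ3.le
          linarith
      _ = σ3 * (Θ + 1) * Δ * Cχ / 4 := by ring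
      _ ≤ η / 16 := hΔη
  have e : σ3 * ΘL / 4 * (Iχ - 2 * τ * ω - Δ * Cχ) =
      σ3 * ΘL / 4 * Iχ - σ3 * ΘL / 4 * (2 * τ * ω) - σ3 * ΘL / 4 * (Δ * Cχ) := by ring
  linarith


/-- The time modulus on `[0, τ]` from the flight modulus (flights of speed `0`). [folklore] -/
theorem modulus_time {χ : ℝ × T3 → ℝ} {τ V ω ϑ Δ : ℝ} (hV : 0 < V) (hΔϑ : Δ ≤ ϑ)
    (hmod : ∀ s ∈ Icc (0 : ℝ) τ, ∀ (y : T3) (t₁ : ℝ), 0 ≤ t₁ → t₁ ≤ ϑ → ∀ v : V3, ‖v‖ ≤ 2 * V →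
      |χ (s + t₁, (Torus.geometry (Fin 3)).translate y (t₁ • v)) - χ (s, y)| ≤ ω) :
    ∀ s ∈ Icc (0 : ℝ) τ, ∀ s' ∈ Icc (0 : ℝ) τ, |s - s'| ≤ Δ → ∀ x : T3, |χ (s, x) - χ (s', x)| ≤ ω := by
  intro s hs s' hs' hss' x
  have hV0 : ‖(0 : V3)‖ ≤ 2 * V := by rw [norm_zero]; linarith
  rcases le_total s s' with hle | hle
  · have h := hmod s hs x (s' - s) (by linarith)
      (by rw [abs_sub_comm, abs_of_nonneg (by linarith)] at hss'; linarith) 0 hV0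
    rw [smul_zero, (Torus.geometry (Fin 3)).translate_zero, add_sub_cancel] at h
    rwa [abs_sub_comm]
  · have h := hmod s' hs' x (s - s') (by linarith) (by rw [abs_of_nonneg (by linarith)] at hss'; linarith) 0 hV0
    rw [smul_zero, (Torus.geometry (Fin 3)).translate_zero, add_sub_cancel] at h
    exact h

/-- `0 ≤ I_χ ≤ τ Cχ` for a continuous weight `0 ≤ χ ≤ Cχ` on `[0, τ] × 𝕋³`. [folklore] -/
theorem Iχ_bounds {χ : ℝ × T3 → ℝ} (hχ : Continuous χ) (hχ0 : ∀ p, 0 ≤ χ p) {τ Cχ : ℝ} (hτ : 0 < τ)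
    (hχC : ∀ s ∈ Icc (0 : ℝ) τ, ∀ x : T3, χ (s, x) ≤ Cχ) :
    0 ≤ (∫ s in Icc (0 : ℝ) τ, ∫ x : T3, χ (s, x)) ∧ (∫ s in Icc (0 : ℝ) τ, ∫ x : T3, χ (s, x)) ≤ τ * Cχ := by
  have hgint : ∀ s, Integrable (fun x : T3 => χ (s, x)) := fun s =>
    integrableOn_univ.mp ((hχ.comp (Continuous.prodMk_right _)).continuousOn.integrableOn_compact isCompact_univ)
  have hgc : Continuous fun s : ℝ => ∫ x : T3, χ (s, x) := continuous_integral_torus hχ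
  refine ⟨setIntegral_nonneg measurableSet_Icc fun s _ => integral_nonneg fun x => hχ0 _, ?_⟩
  calc (∫ s in Icc (0 : ℝ) τ, ∫ x : T3, χ (s, x)) ≤ ∫ _s in Icc (0 : ℝ) τ, Cχ := by
        refine setIntegral_mono_on (hgc.continuousOn.integrableOn_compact isCompact_Icc)
          (continuous_const.continuousOn.integrableOn_compact isCompact_Icc) measurableSet_Icc fun s hs => ?_
        calc ∫ x : T3, χ (s, x) ≤ ∫ _x : T3, Cχ := integral_mono (hgint s) (integrable_const _) (hχC s hs)
          _ = Cχ := by rw [integral_const, probReal_univ, one_smul]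
    _ = τ * Cχ := by rw [setIntegral_const, Real.volume_real_Icc_of_le hτ.le, sub_zero, smul_eq_mul]


/-- **Core estimate at fixed `N`.**  See the module docstring; every smallness condition is a hypothesis. [folklore] -/
theorem core_bound {σ a θ : ℝ} {u : V3} {N : ℕ} (hsd : SmallDensity uniformProfile σ) (hθ : 0 < θ)
    (hlam : ovDensity uniformProfile σ ≤ 1 / 32) (hN : 1 ≤ N)
    (Φ : HardSphereFlow (Torus.geometry (Fin 3)) (hsDiameter σ N) (N + 1))
    {τ : ℝ} (hτ : 0 < τ) {χ : ℝ × T3 → ℝ} (hχ : Continuous χ) (hχ0 : ∀ p, 0 ≤ χ p)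
    {Cχ : ℝ} (hCχ : 0 < Cχ) (hχC : ∀ s ∈ Icc (0 : ℝ) τ, ∀ x : T3, χ (s, x) ≤ Cχ)
    {Ξ : V3 × V3 × V3 → ℝ} (hΞc : Continuous Ξ) (hΞ0 : ∀ q, 0 ≤ Ξ q) {C : ℝ} (hΞC : ∀ q, Ξ q ≤ C)
    {L V : ℝ} (hL : 0 < L) (hV : 0 < V) {r η δ : ℝ} (hη : 0 < η) (hδ : 0 < δ)
    {Θ ΘL ℓ : ℝ} (hΘ : Θ = ∫ p, sphereMark Ξ p.1 p.2 ∂((gaussMeasure u θ).prod (gaussMeasure u θ)))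
    (hΘL : ΘL = ∫ p : V3 × V3, sphereMark (fun q : V3 × V3 × V3 => Ξ q * speedCutoff L ‖q.2.2 - q.2.1‖ * speedCutoff V ‖q.2.1‖)
      p.1 p.2 * (localMaxwellian 1 θ u p.1 * localMaxwellian 1 θ u p.2))
    (hloss : Θ ≤ ΘL + ℓ) (hℓ : σ ^ 3 * ℓ * (τ * Cχ) / 4 ≤ η / 8)
    {ω ϑ : ℝ} (hω : 0 < ω)
    (hmod : ∀ s ∈ Icc (0 : ℝ) τ, ∀ (y : T3) (t₁ : ℝ), 0 ≤ t₁ → t₁ ≤ ϑ → ∀ v : V3, ‖v‖ ≤ 2 * V →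
      |χ (s + t₁, (Torus.geometry (Fin 3)).translate y (t₁ • v)) - χ (s, y)| ≤ ω)
    (hωη : σ ^ 3 * Θ * τ * ω / 2 ≤ η / 16)
    {Δ κ : ℝ} (hΔ : 0 < Δ) (hκε : κ * hsDiameter σ N = Δ) (hΔϑ : Δ ≤ ϑ) (hΔτ : Δ ≤ τ / 2)
    (hsmall4 : hsDiameter σ N * (1 + 4 * κ * L) < 1 / 2)
    (hΔη : σ ^ 3 * (Θ + 1) * Δ * Cχ / 4 ≤ η / 16)
    {ρ f t : ℝ} (hρ : 0 < ρ) (hρη : ρ * σ ^ 3 * τ ≤ η / 8) (hf : 0 < f)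
    (hfη : f * τ * σ ^ 3 * Cχ * (Θ + 1) ≤ η / 8)
    (ht : t = ρ * ((N + 1 : ℕ) : ℝ) * N * hsDiameter σ N ^ 3 * κ)
    -- the one-window Chebyshev bound for every admissible weight (the ONLY place the decorrelation plateau enters:
    -- `measure_tubeSum_le_mean_sub_le_sharp` + the smallness of the variance ratio, supplied by the assembly)
    (hcheb : ∀ χw : T3 → ℝ, Continuous χw → (∀ y, 0 ≤ χw y) → (∀ y, χw y ≤ Cχ) →
      localGibbsLaw σ (fun _ => a) (fun _ => u) (fun _ => θ) N Φ
        {z | (∑ i : Fin (N + 1), ∑ j : Fin (N + 1), (if i ≠ j then χw (z i).1 *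
            pairTubeMark (hsDiameter σ N) κ (fun q : V3 × V3 × V3 => Ξ q * speedCutoff L ‖q.2.2 - q.2.1‖ * speedCutoff V ‖q.2.1‖)
              i j (fun m => (z m).1) (fun m => (z m).2) else 0)) ≤
          ((N + 1 : ℕ) : ℝ) * N * ((∫ y, χw y) * ((1 - 16 * ovDensity uniformProfile σ) * hsDiameter σ N ^ 3 * κ * ΘL)) - t} ≤
        ENNReal.ofReal (δ * f / 2))
    (hB : localGibbsLaw σ (fun _ => a) (fun _ => u) (fun _ => θ) N Φ
        {z | Θ * (∫ s in Icc (0 : ℝ) τ, ∫ x : T3, χ (s, x)) + η / σ ^ 3 <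
            ∫ s in Icc (0 : ℝ) τ, ∫ x : T3, χ (s, x) * pairFunctional r Ξ (Φ.flow s z) x} ≤ ENNReal.ofReal (δ / 2)) :
    localGibbsLaw σ (fun _ => a) (fun _ => u) (fun _ => θ) N Φ
        {z | lineSW (hsDiameter σ N) Δ τ (fun s => Φ.flow s z)
              (fun u' x y v w => χ (u', x) * Ξ ((hsDiameter σ N)⁻¹ • (Torus.geometry (Fin 3)).sepVec x y, v, w)) <
            1 / 8 * σ ^ 3 * (∫ s in Icc (0 : ℝ) τ, ∫ x : T3, χ (s, x) * pairFunctional r Ξ (Φ.flow s z) x) - η} ≤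
      ENNReal.ofReal δ := by
  have hσ := hsd.σ_pos
  have hσ2 : σ ≤ 1 / 2 := hsd.σ_lt_half.le
  have hσ3 : 0 < σ ^ 3 := pow_pos hσ 3
  have hε := hsDiameter_pos hσ N
  have hn0 : (0 : ℝ) < ((N + 1 : ℕ) : ℝ) := by positivity
  have hN0 : (0 : ℝ) < N := by exact_mod_cast hN
  have hN1 : (1 : ℝ) ≤ N := by exact_mod_cast hN
  have hNn : (N : ℝ) ≤ ((N + 1 : ℕ) : ℝ) := by push_cast; linarith
  have hnN : ((N + 1 : ℕ) : ℝ) ≤ 2 * N := by push_cast; linarith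
  have hκ : 0 < κ := by
    have e : κ = Δ / hsDiameter σ N := by rw [← hκε, mul_div_cancel_right₀ _ hε.ne']
    rw [e]; exact div_pos hΔ hε
  have ht0 : 0 < t := by rw [ht]; exact mul_pos (mul_pos (mul_pos (mul_pos hρ hn0) hN0) (pow_pos hε 3)) hκ
  set K := ⌊τ / Δ⌋₊ with hKdef
  have hK1 : 1 ≤ K := by
    rw [hKdef, Nat.one_le_floor_iff, le_div_iff₀ hΔ]; linarith
  have hK0 : (0 : ℝ) < K := by exact_mod_cast hK1
  have hKΔ : (K : ℝ) * Δ ≤ τ := by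
    have h := Nat.floor_le (div_nonneg hτ.le hΔ.le)
    rw [← hKdef] at h
    calc (K : ℝ) * Δ ≤ τ / Δ * Δ := mul_le_mul_of_nonneg_right h hΔ.le
      _ = τ := div_mul_cancel₀ τ hΔ.ne'
  set Ξ' : V3 × V3 × V3 → ℝ := fun q => Ξ q * speedCutoff L ‖q.2.2 - q.2.1‖ * speedCutoff V ‖q.2.1‖ with hΞ'def
  have hΞ'c : Continuous Ξ' := RateFloorCutoffLoss.continuous_trunc₂ hΞc L V
  have hΞ'0 : ∀ q, 0 ≤ Ξ' q := fun q => (RateFloorCutoffLoss.trunc₂_nonneg_le hΞ0 L V q).1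
  have hΞ'le : ∀ q, Ξ' q ≤ Ξ q := fun q => (RateFloorCutoffLoss.trunc₂_nonneg_le hΞ0 L V q).2
  have hΞ'L : ∀ m v v' : V3, 2 * L ≤ ‖v - v'‖ → Ξ' (m, v, v') = 0 := fun m v v' h =>
    RateFloorCutoffLoss.trunc₂_eq_zero_of_speed hL V m v v' h
  have hΞ'V : ∀ m v v' : V3, 2 * V ≤ ‖v‖ → Ξ' (m, v, v') = 0 := fun m v v' h =>
    RateFloorCutoffLoss.trunc₂_eq_zero_of_norm L hV m v v' h
  have hΘ0 : 0 ≤ Θ := by rw [hΘ]; exact integral_nonneg fun p => RateFloorPairFunctionalUpper.sphereMark_nonneg' hΞ0 _ _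
  have hΘL_eq : ΘL = ∫ p, sphereMark Ξ' p.1 p.2 ∂((gaussMeasure u θ).prod (gaussMeasure u θ)) := by
    rw [hΘL]; exact (integral_prod_gaussMeasure hθ u _).symm
  have hΘL0 : 0 ≤ ΘL := by
    rw [hΘL_eq]; exact integral_nonneg fun p => RateFloorPairFunctionalUpper.sphereMark_nonneg' hΞ'0 _ _
  have hΘLle : ΘL ≤ Θ := by
    rw [hΘL_eq, hΘ]
    exact integral_mono (RateFloorCutoffLoss.integrable_sphereMark_prod_gauss hΞ'c hΞ'0 (fun q => (hΞ'le q).trans (hΞC q)) u θ)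
      (RateFloorCutoffLoss.integrable_sphereMark_prod_gauss hΞc hΞ0 hΞC u θ)
      fun p => RateFloorPairFunctionalUpper.sphereMark_mono hΞ'c hΞc hΞ'le _ _
  have htk : ∀ k : Fin K, ((k : ℕ) : ℝ) * Δ ∈ Icc (0 : ℝ) τ := fun k => by
    refine ⟨mul_nonneg (Nat.cast_nonneg _) hΔ.le, ?_⟩
    have : ((k : ℕ) : ℝ) ≤ K := by exact_mod_cast k.2.le
    exact (mul_le_mul_of_nonneg_right this hΔ.le).trans hKΔ
  set χt : Fin K → T3 → ℝ := fun k y => max (χ (((k : ℕ) : ℝ) * Δ, y) - ω) 0 with hχtdef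
  have hχtc : ∀ k, Continuous (χt k) := fun k =>
    ((hχ.comp (Continuous.prodMk_right _)).sub continuous_const).max continuous_const
  have hχt0 : ∀ (k : Fin K) (y : T3), 0 ≤ χt k y := fun k y => le_max_right _ _
  have hχtle : ∀ (k : Fin K) (y : T3), χt k y ≤ χ (((k : ℕ) : ℝ) * Δ, y) := fun k y => max_le (by linarith [hω.le]) (hχ0 _)
  have hχtC : ∀ (k : Fin K) (y : T3), χt k y ≤ Cχ := fun k y => (hχtle k y).trans (hχC _ (htk k) y)
  have hχtge : ∀ (k : Fin K) (y : T3), χ (((k : ℕ) : ℝ) * Δ, y) - ω ≤ χt k y := fun k y => le_max_left _ _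
  set S : Fin K → Config (N + 1) (Fin 3) T3 → ℝ := fun k z => ∑ i : Fin (N + 1), ∑ j : Fin (N + 1),
    (if i ≠ j then χt k (z i).1 * pairTubeMark (hsDiameter σ N) κ Ξ' i j (fun m => (z m).1) (fun m => (z m).2) else 0)
    with hSdef
  have hS0 : ∀ (k : Fin K) (z : Config (N + 1) (Fin 3) T3), 0 ≤ S k z := fun k z => Finset.sum_nonneg fun i _ => Finset.sum_nonneg fun j _ => by
    split_ifs
    · refine mul_nonneg (hχt0 k _) ?_
      rw [pairTubeMark_config_eq]; split_ifs; exacts [hΞ'0 _, le_rfl]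
    · exact le_rfl
  have hSm : ∀ k, Measurable (S k) := fun k => measurable_tubeSum (hsDiameter σ N) κ (hχtc k) hΞ'c
  set m : Fin K → ℝ := fun k => ((N + 1 : ℕ) : ℝ) * N *
    ((∫ y, χt k y) * ((1 - 16 * ovDensity uniformProfile σ) * hsDiameter σ N ^ 3 * κ * ΘL)) with hmdef
  set Bad : Fin K → Set (Config (N + 1) (Fin 3) T3) := fun k => {z | S k z ≤ m k - t} with hBaddef
  have hBadm : ∀ k, MeasurableSet (Bad k) := fun k => measurableSet_le (hSm k) measurable_const
  -- Chebyshev, window by window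
  have hBadG : ∀ k, localGibbsLaw σ (fun _ => a) (fun _ => u) (fun _ => θ) N Φ (Bad k) ≤ ENNReal.ofReal (δ * f / 2) := fun k =>
    hcheb (χt k) (hχtc k) (hχt0 k) (hχtC k)
  -- Markov over windows
  have hW : localGibbsLaw σ (fun _ => a) (fun _ => u) (fun _ => θ) N Φ
      {z | f * K ≤ ∑ k : Fin K, (Bad k).indicator (fun _ => (1 : ℝ)) (Φ.flow (((k : ℕ) : ℝ) * Δ) z)} ≤
      ENNReal.ofReal (δ / 2) := by
    have h1 := measure_le_card_windows_mem_le' σ a θ u N Φ hBadm (fun k : Fin K => ((k : ℕ) : ℝ) * Δ) hBadG (mul_pos hf hK0)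
    refine h1.trans ?_
    have e1 : ((K : ℝ≥0∞) * ENNReal.ofReal (δ * f / 2)) / ENNReal.ofReal (f * K) = ENNReal.ofReal (K * (δ * f / 2) / (f * K)) := by
      rw [ENNReal.ofReal_div_of_pos (mul_pos hf hK0), ENNReal.ofReal_mul (Nat.cast_nonneg K), ENNReal.ofReal_natCast]
    rw [e1]
    refine ENNReal.ofReal_le_ofReal (le_of_eq ?_)
    field_simp
  have hmodt := modulus_time (χ := χ) (τ := τ) hV hΔϑ hmod
  obtain ⟨hIχ0, hIχle⟩ := Iχ_bounds hχ hχ0 hτ hχC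
  have hintχt : ∀ k, Integrable (χt k) (volume : Measure T3) := fun k =>
    integrableOn_univ.mp ((hχtc k).continuousOn.integrableOn_compact isCompact_univ)
  have hIχt_le : ∀ k : Fin K, ∫ y, χt k y ≤ Cχ := fun k => by
    calc ∫ y, χt k y ≤ ∫ _y : T3, Cχ := integral_mono (hintχt k) (integrable_const _) (hχtC k)
      _ = Cχ := by rw [integral_const, probReal_univ, one_smul]
  have hIχt_ge : ∀ k : Fin K, (∫ y, χ (((k : ℕ) : ℝ) * Δ, y)) - ω ≤ ∫ y, χt k y := fun k => by
    have hik : Integrable (fun y : T3 => χ (((k : ℕ) : ℝ) * Δ, y)) :=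
      integrableOn_univ.mp ((hχ.comp (Continuous.prodMk_right _)).continuousOn.integrableOn_compact isCompact_univ)
    calc (∫ y, χ (((k : ℕ) : ℝ) * Δ, y)) - ω = ∫ y : T3, (χ (((k : ℕ) : ℝ) * Δ, y) - ω) := by
          rw [integral_sub hik (integrable_const ω), integral_const, probReal_univ, one_smul]
      _ ≤ ∫ y, χt k y := integral_mono (hik.sub (integrable_const ω)) (hintχt k) (hχtge k)
  -- the Riemann sum of the truncated weights
  have hX : (∫ s in Icc (0 : ℝ) τ, ∫ x : T3, χ (s, x)) - 2 * τ * ω - Δ * Cχ ≤ Δ * ∑ k : Fin K, ∫ y, χt k y := by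
    have hRiem := integral_le_riemann_add hχ hχ0 hτ hχC hΔ hω.le hmodt
    rw [← hKdef, ← Fin.sum_univ_eq_sum_range] at hRiem
    have h2 : ∑ k : Fin K, ((∫ y, χ (((k : ℕ) : ℝ) * Δ, y)) - ω) ≤ ∑ k : Fin K, ∫ y, χt k y :=
      Finset.sum_le_sum fun k _ => hIχt_ge k
    rw [Finset.sum_sub_distrib, Finset.sum_const, Finset.card_univ, Fintype.card_fin, nsmul_eq_mul] at h2
    have h3 : (K : ℝ) * Δ * ω ≤ τ * ω := mul_le_mul_of_nonneg_right hKΔ hω.le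
    have h4 := mul_le_mul_of_nonneg_left h2 hΔ.le
    rw [mul_sub] at h4
    linarith [h4, h3, hRiem]
  have hX0 : 0 ≤ Δ * ∑ k : Fin K, ∫ y, χt k y := mul_nonneg hΔ.le (Finset.sum_nonneg fun k _ => integral_nonneg (hχt0 k))
  have h16 : 1 / 2 ≤ 1 - 16 * ovDensity uniformProfile σ := by linarith
  have h16' : 1 - 16 * ovDensity uniformProfile σ ≤ 1 := by linarith [hsd.ovDensity_nonneg]
  have hε3 : hsDiameter σ N ^ 3 = σ ^ 3 / ((N + 1 : ℕ) : ℝ) := hsDiameter_pow_three σ N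
  have hP1 : σ ^ 3 / 2 ≤ N * σ ^ 3 / ((N + 1 : ℕ) : ℝ) := by
    rw [div_le_div_iff₀ (by norm_num) hn0]
    have := mul_le_mul_of_nonneg_left hnN hσ3.le
    linarith
  have hP2 : N * σ ^ 3 / ((N + 1 : ℕ) : ℝ) ≤ σ ^ 3 := by
    rw [div_le_iff₀ hn0]
    have := mul_le_mul_of_nonneg_left hNn hσ3.le
    linarith
  have hincl : {z | lineSW (hsDiameter σ N) Δ τ (fun s => Φ.flow s z)
          (fun u' x y v w => χ (u', x) * Ξ ((hsDiameter σ N)⁻¹ • (Torus.geometry (Fin 3)).sepVec x y, v, w)) <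
        1 / 8 * σ ^ 3 * (∫ s in Icc (0 : ℝ) τ, ∫ x : T3, χ (s, x) * pairFunctional r Ξ (Φ.flow s z) x) - η} ⊆
      {z | Θ * (∫ s in Icc (0 : ℝ) τ, ∫ x : T3, χ (s, x)) + η / σ ^ 3 <
          ∫ s in Icc (0 : ℝ) τ, ∫ x : T3, χ (s, x) * pairFunctional r Ξ (Φ.flow s z) x} ∪
      {z | f * K ≤ ∑ k : Fin K, (Bad k).indicator (fun _ => (1 : ℝ)) (Φ.flow (((k : ℕ) : ℝ) * Δ) z)} := by
    intro z hz
    simp only [mem_setOf_eq] at hz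
    by_contra hnot
    simp only [mem_union, mem_setOf_eq, not_or, not_lt, not_le] at hnot
    obtain ⟨hBz, hWz⟩ := hnot
    -- (1) window by window: the would-be sum dominates the static sum at the window start
    have hwin : ∀ k : Fin K, S k (Φ.flow (((k : ℕ) : ℝ) * Δ) z) ≤
        wouldBeSum (hsDiameter σ N) Δ (Φ.flow (((k : ℕ) : ℝ) * Δ) z) (((k : ℕ) : ℝ) * Δ)
          (fun u' x y v w => χ (u', x) * Ξ ((hsDiameter σ N)⁻¹ • (Torus.geometry (Fin 3)).sepVec x y, v, w)) := fun k => by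
      have h := tubeSum_trunc_le_wouldBeSum (n := N + 1) hε hκ.le hsmall4 (Φ.flow (((k : ℕ) : ℝ) * Δ) z) (((k : ℕ) : ℝ) * Δ)
        hχ0 hΞ0 hΞ'le hΞ'L hΞ'V (hχt0 k) (fun y t₁ v ht0' ht1 hv => by
          have ht1' : t₁ ≤ ϑ := by rw [hκε] at ht1; exact ht1.trans hΔϑ
          have hm := hmod _ (htk k) y t₁ ht0'.le ht1' v hv.le
          have h2 := (abs_sub_le_iff.1 hm).2
          exact max_le (by linarith) (hχ0 _))
      rw [hκε] at h
      exact h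
    -- (2) few bad windows
    have hcoef0 : 0 ≤ (1 - 16 * ovDensity uniformProfile σ) * hsDiameter σ N ^ 3 * κ * ΘL :=
      mul_nonneg (mul_nonneg (mul_nonneg (by linarith) (pow_pos hε 3).le) hκ.le) hΘL0
    have hmle : ∀ k, m k ≤ ((N + 1 : ℕ) : ℝ) * N * (Cχ * ((1 - 16 * ovDensity uniformProfile σ) * hsDiameter σ N ^ 3 * κ * ΘL)) :=
      fun k => mul_le_mul_of_nonneg_left (mul_le_mul_of_nonneg_right (hIχt_le k) hcoef0) (mul_nonneg hn0.le hN0.le)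
    have hmbar0 : 0 ≤ ((N + 1 : ℕ) : ℝ) * N * (Cχ * ((1 - 16 * ovDensity uniformProfile σ) * hsDiameter σ N ^ 3 * κ * ΘL)) :=
      mul_nonneg (mul_nonneg hn0.le hN0.le) (mul_nonneg hCχ.le hcoef0)
    have hbadcount : (∑ k : Fin K, if S k (Φ.flow (((k : ℕ) : ℝ) * Δ) z) ≤ m k - t then (1 : ℝ) else 0) < f * K := by
      have e : ∀ k : Fin K, (Bad k).indicator (fun _ => (1 : ℝ)) (Φ.flow (((k : ℕ) : ℝ) * Δ) z) =
          if S k (Φ.flow (((k : ℕ) : ℝ) * Δ) z) ≤ m k - t then (1 : ℝ) else 0 := fun k => by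
        simp only [hBaddef, Set.indicator_apply, mem_setOf_eq]
      simpa only [e] using hWz
    have hfew := sum_ge_of_few_bad (W := fun k => S k (Φ.flow (((k : ℕ) : ℝ) * Δ) z)) (fun k => hS0 k _) hmle ht0.le hmbar0
      hbadcount
    -- (3) the would-be functional dominates
    have hSW : hsDiameter σ N / ((N + 1 : ℕ) : ℝ) * ((∑ k : Fin K, m k) - K * t -
        f * K * (((N + 1 : ℕ) : ℝ) * N * (Cχ * ((1 - 16 * ovDensity uniformProfile σ) * hsDiameter σ N ^ 3 * κ * ΘL)))) ≤
        lineSW (hsDiameter σ N) Δ τ (fun s => Φ.flow s z)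
          (fun u' x y v w => χ (u', x) * Ξ ((hsDiameter σ N)⁻¹ • (Torus.geometry (Fin 3)).sepVec x y, v, w)) := by
      have e : lineSW (hsDiameter σ N) Δ τ (fun s => Φ.flow s z)
          (fun u' x y v w => χ (u', x) * Ξ ((hsDiameter σ N)⁻¹ • (Torus.geometry (Fin 3)).sepVec x y, v, w)) =
          hsDiameter σ N / ((N + 1 : ℕ) : ℝ) * ∑ k : Fin K, wouldBeSum (hsDiameter σ N) Δ (Φ.flow (((k : ℕ) : ℝ) * Δ) z)
            (((k : ℕ) : ℝ) * Δ) (fun u' x y v w => χ (u', x) * Ξ ((hsDiameter σ N)⁻¹ • (Torus.geometry (Fin 3)).sepVec x y, v, w)) := by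
        simp only [lineSW, ← hKdef, ← Fin.sum_univ_eq_sum_range]
      rw [e]
      exact mul_le_mul_of_nonneg_left (hfew.trans (Finset.sum_le_sum fun k _ => hwin k)) (div_nonneg hε.le hn0.le)
    -- (4) the scalar form of the floor
    have hSW' : (N * σ ^ 3 / ((N + 1 : ℕ) : ℝ)) * (1 - 16 * ovDensity uniformProfile σ) * ΘL * (Δ * ∑ k : Fin K, ∫ y, χt k y) -
        ρ * (N * σ ^ 3 / ((N + 1 : ℕ) : ℝ)) * (K * Δ) -
        f * (K * Δ) * (N * σ ^ 3 / ((N + 1 : ℕ) : ℝ)) * Cχ * (1 - 16 * ovDensity uniformProfile σ) * ΘL ≤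
        lineSW (hsDiameter σ N) Δ τ (fun s => Φ.flow s z)
          (fun u' x y v w => χ (u', x) * Ξ ((hsDiameter σ N)⁻¹ • (Torus.geometry (Fin 3)).sepVec x y, v, w)) := by
      refine le_trans (le_of_eq ?_) hSW
      have hn' : ((N + 1 : ℕ) : ℝ) ≠ 0 := hn0.ne'
      simp only [hmdef, ← Finset.mul_sum, ← Finset.sum_mul, ht]
      rw [← hκε, hε3]
      field_simp
    have hfloor := floor_arith hσ3 hP1 hP2 h16 h16' hΘL0 hΘLle hloss hX0 hX hIχ0 hIχle hτ hω.le hΔ.le hCχ.le hρ.le hf.le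
      (mul_nonneg hK0.le hΔ.le) hKΔ hℓ hωη hΔη hρη hfη hSW'
    -- (5) contradiction with the B-side
    have hup := mul_le_mul_of_nonneg_left hBz hσ3.le
    have e : σ ^ 3 * (Θ * (∫ s in Icc (0 : ℝ) τ, ∫ x : T3, χ (s, x)) + η / σ ^ 3) =
        σ ^ 3 * Θ * (∫ s in Icc (0 : ℝ) τ, ∫ x : T3, χ (s, x)) + η := by field_simp
    rw [e] at hup
    have hΘI : 0 ≤ σ ^ 3 * Θ * (∫ s in Icc (0 : ℝ) τ, ∫ x : T3, χ (s, x)) := by positivity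
    linarith
  calc localGibbsLaw σ (fun _ => a) (fun _ => u) (fun _ => θ) N Φ
        {z | lineSW (hsDiameter σ N) Δ τ (fun s => Φ.flow s z)
              (fun u' x y v w => χ (u', x) * Ξ ((hsDiameter σ N)⁻¹ • (Torus.geometry (Fin 3)).sepVec x y, v, w)) <
            1 / 8 * σ ^ 3 * (∫ s in Icc (0 : ℝ) τ, ∫ x : T3, χ (s, x) * pairFunctional r Ξ (Φ.flow s z) x) - η}
      ≤ localGibbsLaw σ (fun _ => a) (fun _ => u) (fun _ => θ) N Φ
          ({z | Θ * (∫ s in Icc (0 : ℝ) τ, ∫ x : T3, χ (s, x)) + η / σ ^ 3 <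
              ∫ s in Icc (0 : ℝ) τ, ∫ x : T3, χ (s, x) * pairFunctional r Ξ (Φ.flow s z) x} ∪
            {z | f * K ≤ ∑ k : Fin K, (Bad k).indicator (fun _ => (1 : ℝ)) (Φ.flow (((k : ℕ) : ℝ) * Δ) z)}) :=
        measure_mono hincl
    _ ≤ _ := measure_union_le _ _
    _ ≤ ENNReal.ofReal (δ / 2) + ENNReal.ofReal (δ / 2) := add_le_add hB hW
    _ = ENNReal.ofReal δ := by rw [← ENNReal.ofReal_add (by positivity) (by positivity)]; ring_nf

/-- Registered stub `stub_modulusTimeRung0` of crux stmt-AtomisticToContinuum-13080 (line `Sketch`, c2 lane): the closed form of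
`modulus_time`. -/
theorem stub_modulusTimeRung0 : ∀ (χ : ℝ × T3 → ℝ) (τ V ω ϑ Δ : ℝ), 0 < V → Δ ≤ ϑ → (∀ s ∈ Set.Icc (0 : ℝ) τ, ∀ (y : T3) (t₁ : ℝ), 0 ≤ t₁ → t₁ ≤ ϑ → ∀ v : V3, ‖v‖ ≤ 2 * V → |χ (s + t₁, (Torus.geometry (Fin 3)).translate y (t₁ • v)) - χ (s, y)| ≤ ω) → ∀ s ∈ Set.Icc (0 : ℝ) τ, ∀ s' ∈ Set.Icc (0 : ℝ) τ, |s - s'| ≤ Δ → ∀ x : T3, |χ (s, x) - χ (s', x)| ≤ ω :=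
  fun _χ _τ _V _ω _ϑ _Δ hV hΔϑ hmod => modulus_time hV hΔϑ hmod

end RateFloorStaticFloor

end Summit.AtomisticToContinuum.HydrodynamicLimit.Theorems

end
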